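import Summits.Ventures.CertifiedManyBodySolver.Rows.SpinChainMPSNodes

/-!
# Integer twins for the rational side conditions of the `relax = mps(N, D, A)` nodes
# (dyadic tensor `A^s = Az^s / 2^a`, integer transfer matrix `Tz = Σ_s Az^s ⊗ Az^s`, staged powers)

HONEST FRAMING: first certified bounds; not a superconductivity verdict; every number certified or labelled float.

WHAT THIS FILE IS (speedrun cell sr-mbsolver, LIT team lit-1 gen-8). The cells BY NAME of the `mps` nodes
(`MPSSpinChainNode.energyDensity_ge`, `MPSChainKSDNNode.ltiChainKSDNNode`, …) take the a-priori-bound side condition in exact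
rational form, `∀ k, k + 4 ≤ N → 0 ≤ B (k+4) ∧ frobSqQ (transferOpQ A ^ (k+2)) ≤ B (k+4)²` (FORMAT-ltisdp §4.7:
`B_k = ceil_{2^20} √‖T^k‖_F²`, `T = Σ_s A^s ⊗ A^s`). Lane-B tensors are DYADIC (`meta.A` = `Az / 2^a` with integer `Az`), so the
check is an INTEGER computation the Lean kernel can run from literal tables, exactly as for the uMPS upper certificates
(`Upper/UMPSKernelTwins.lean`): with `Tz = transferOpZ Az = Σ_s Az^s ⊗ₖ Az^s`,
  `frobSqQ (transferOpQ (dyadicTensorQ Az a) ^ k) = frobSqZ (Tz ^ k) / 2^(4 a k)`   (`frobSqQ_transferOpQ_dyadicTensorQ_pow`),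
and the powers `Tz ^ k` are supplied by the instance as a TABLE `P k` checked one product at a time
(`pow_eq_of_stagedProducts`: `P 0 = 1`, `P (j+1) = P j * Tz` ⇒ `Tz ^ k = P k`; each step is a `decide` on `D² × D²` integer
matrices). `mpsBounds_of_twin` assembles the side condition of the cells from these kernel-checkable Booleans/equalities.
Definitions with bodies only; no `sorry`, no new axiom, no named fact. [cite: KullEtAl2024, §2.5]
-/

namespace Summit.Ventures.CertifiedManyBodySolver

open Matrix
open scoped Kronecker BigOperators

/-! ## §A  The twins -/

section Twins

variable {q D : ℕ}

/-- The dyadic rational MPS tensor of an integer twin: `A^s = Az^s / 2^a` (`meta.A` of a lane-B problem file, exactly).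
[cite: KullEtAl2024, §2.5] -/
def dyadicTensorQ (Az : Fin q → Matrix (Fin D) (Fin D) ℤ) (a : ℕ) : Fin q → Matrix (Fin D) (Fin D) ℚ :=
  fun s => ((2 : ℚ) ^ a)⁻¹ • (Az s).map ((↑) : ℤ → ℚ)

/-- Entries of `dyadicTensorQ Az a`. -/
@[simp] theorem dyadicTensorQ_apply (Az : Fin q → Matrix (Fin D) (Fin D) ℤ) (a : ℕ) (s : Fin q) (i j : Fin D) :
    dyadicTensorQ Az a s i j = ((2 : ℚ) ^ a)⁻¹ * (Az s i j : ℚ) := rfl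

/-- The INTEGER transfer matrix `Tz = Σ_s Az^s ⊗ Az^s` (FORMAT-ltisdp §4.7's `T` for the twin, index `((a,a'),(b,b'))`). -/
def transferOpZ (Az : Fin q → Matrix (Fin D) (Fin D) ℤ) : Matrix (Fin D × Fin D) (Fin D × Fin D) ℤ :=
  ∑ s, Az s ⊗ₖ Az s

/-- The exact sum of squares of an integer matrix. -/
def frobSqZ {m m' : Type*} [Fintype m] [Fintype m'] (M : Matrix m m' ℤ) : ℤ := ∑ i, ∑ j, M i j ^ 2

/-- `frobSqQ (c • M) = c² · frobSqQ M`. -/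
theorem frobSqQ_smul {m m' : Type*} [Fintype m] [Fintype m'] (c : ℚ) (M : Matrix m m' ℚ) :
    frobSqQ (c • M) = c ^ 2 * frobSqQ M := by
  simp only [frobSqQ, Matrix.smul_apply, smul_eq_mul, mul_pow, Finset.mul_sum]

/-- `frobSqQ` of a cast integer matrix is the cast of `frobSqZ`. -/
theorem frobSqQ_map_intCast {m m' : Type*} [Fintype m] [Fintype m'] (M : Matrix m m' ℤ) :
    frobSqQ (M.map ((↑) : ℤ → ℚ)) = (frobSqZ M : ℚ) := by
  simp only [frobSqQ, frobSqZ, Matrix.map_apply, Int.cast_sum, Int.cast_pow]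

/-- The rational transfer matrix of the dyadic tensor is the scaled cast of the integer one:
`transferOpQ (Az / 2^a) = 4^{-a} · Tz`. -/
theorem transferOpQ_dyadicTensorQ (Az : Fin q → Matrix (Fin D) (Fin D) ℤ) (a : ℕ) :
    transferOpQ (dyadicTensorQ Az a) = (((2 : ℚ) ^ a)⁻¹) ^ 2 • (transferOpZ Az).map ((↑) : ℤ → ℚ) := by
  ext ⟨i, i'⟩ ⟨j, j'⟩
  rw [transferOpQ, transferOpZ, Matrix.sum_apply, Matrix.smul_apply, Matrix.map_apply, Matrix.sum_apply, Int.cast_sum,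
    smul_eq_mul, Finset.mul_sum]
  refine Finset.sum_congr rfl fun s _ => ?_
  rw [Matrix.kroneckerMap_apply, Matrix.kroneckerMap_apply, dyadicTensorQ_apply, dyadicTensorQ_apply, Int.cast_mul]
  ring

/-- Powers: `transferOpQ (Az / 2^a) ^ k = 4^{-a k} · (Tz ^ k)`. -/
theorem transferOpQ_dyadicTensorQ_pow (Az : Fin q → Matrix (Fin D) (Fin D) ℤ) (a k : ℕ) :
    transferOpQ (dyadicTensorQ Az a) ^ k = ((((2 : ℚ) ^ a)⁻¹) ^ 2) ^ k • (transferOpZ Az ^ k).map ((↑) : ℤ → ℚ) := by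
  rw [transferOpQ_dyadicTensorQ, smul_pow]
  congr 1
  exact (map_pow (Int.castRingHom ℚ).mapMatrix (transferOpZ Az) k).symm

/-- **The side condition's left-hand side as an integer computation**:
`frobSqQ (transferOpQ (Az / 2^a) ^ k) = frobSqZ (Tz ^ k) / 2^(4 a k)`. -/
theorem frobSqQ_transferOpQ_dyadicTensorQ_pow (Az : Fin q → Matrix (Fin D) (Fin D) ℤ) (a k : ℕ) :
    frobSqQ (transferOpQ (dyadicTensorQ Az a) ^ k) = (frobSqZ (transferOpZ Az ^ k) : ℚ) / 2 ^ (4 * a * k) := by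
  rw [transferOpQ_dyadicTensorQ_pow, frobSqQ_smul, frobSqQ_map_intCast, div_eq_inv_mul]
  congr 1
  rw [show 4 * a * k = a * 2 * k * 2 by ring, pow_mul, pow_mul, pow_mul]
  simp only [inv_pow]

end Twins

/-! ## §B  Staged powers and the assembled side condition -/

section Staged

variable {m : Type*} [Fintype m] [DecidableEq m]

/-- **Powers from a table of products checked one step at a time**: if `P 0 = 1` and `P (j+1) = P j · T` for `j < k`, then
`T ^ k = P k` (each step is a decidable equality of integer matrices). -/
theorem pow_eq_of_stagedProducts (T : Matrix m m ℤ) (P : ℕ → Matrix m m ℤ) (k : ℕ) (h0 : P 0 = 1)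
    (hs : ∀ j, j < k → P (j + 1) = P j * T) : T ^ k = P k := by
  induction k with
  | zero => rw [pow_zero, h0]
  | succ k ih =>
    rw [pow_succ, ih fun j hj => hs j (Nat.lt_succ_of_lt hj), hs k (Nat.lt_succ_self k)]

variable {q D : ℕ}

/-- **The a-priori-bound side condition of the `mps` cells from integer data.** For a dyadic tensor `A = Az / 2^a`, a table
`P` of staged powers of `Tz = transferOpZ Az` (`P 0 = 1`, `P (j+1) = P j · Tz` for `j + 3 ≤ N`) and bounds `B` with `0 ≤ B m` and
`frobSqZ (P (m−2)) ≤ (B m)² · 2^(4 a (m−2))` (`4 ≤ m ≤ N`): the hypothesis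
`∀ k, k + 4 ≤ N → 0 ≤ B (k+4) ∧ frobSqQ (transferOpQ A ^ (k+2)) ≤ B (k+4)²` of `MPSSpinChainNode.energyDensity_ge` /
`MPSChainKSDNNode.ltiChainKSDNNode`. -/
theorem mpsBounds_of_twin (Az : Fin q → Matrix (Fin D) (Fin D) ℤ) (a N : ℕ) (B : ℕ → ℚ)
    (P : ℕ → Matrix (Fin D × Fin D) (Fin D × Fin D) ℤ) (h0 : P 0 = 1)
    (hs : ∀ j, j + 3 ≤ N → P (j + 1) = P j * transferOpZ Az)
    (hB : ∀ k, k + 4 ≤ N → 0 ≤ B (k + 4) ∧ (frobSqZ (P (k + 2)) : ℚ) ≤ B (k + 4) ^ 2 * 2 ^ (4 * a * (k + 2))) :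
    ∀ k, k + 4 ≤ N → 0 ≤ B (k + 4) ∧ frobSqQ (transferOpQ (dyadicTensorQ Az a) ^ (k + 2)) ≤ B (k + 4) ^ 2 := by
  intro k hk
  refine ⟨(hB k hk).1, ?_⟩
  rw [frobSqQ_transferOpQ_dyadicTensorQ_pow,
    pow_eq_of_stagedProducts (transferOpZ Az) P (k + 2) h0 fun j hj => hs j (by omega),
    div_le_iff₀ (by positivity)]
  exact (hB k hk).2

end Staged

end Summit.Ventures.CertifiedManyBodySolver
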